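import Mathlib
import Summits.AtomisticToContinuum.Crystallization.Theorems.CleanLimitsHaveWindows.Negative.RulerStackingClean

/-!
# `CleanLimitsHaveWindows` (stmt-AtomisticToContinuum-15932), negative side III: window lemmas

Support file 3/4 of `cleanLimitsHaveWindows_false_without_groundState` (standing disprover
refuter-cdisprove-stmt-AtomisticToContinuum-15932-0): elementary lemmas for the window argument of
file 4 — relative density of periodic point sets (L1), third coordinates of stacking points (L2),
coordinate bound (L3), a point of every layer near any point of space (L4), the lateral lattice
`ℤu + ℤv + ℤw` modulo `ℤu + ℤv ≅ ℤ/3` (L5), the first-exit argument producing a TRANSVERSE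
almost-period (L6), a far point opposite to a translate, and the coordinate form of a double
difference of stacking points.

No definitions. All `[folklore]`.
-/

noncomputable section

namespace Summit.AtomisticToContinuum.Crystallization.Theorems.CleanLimitsHaveWindows.Negative

open Literature.MathematicalPhysics.StatisticalMechanics

/-- (L1) **The point set of a periodic configuration is relatively dense**: within `Σ ‖bᵢ‖` of
every point of space, for a `ℤ`-basis `b` of the lattice of periods (`ZSpan.norm_fract_le`).
[folklore] -/
theorem dense_points (P : PeriodicConfiguration 3) :
    ∃ D : ℝ, 0 ≤ D ∧ ∀ z : (EuclideanSpace ℝ (Fin 3)), ∃ q ∈ P.points, dist z q ≤ D := by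
  classical
  haveI : Module.Finite ℤ P.lattice := ZLattice.module_finite ℝ P.lattice
  let b := Module.Free.chooseBasis ℤ P.lattice
  let B := b.ofZLatticeBasis ℝ P.lattice
  obtain ⟨y₀, hy₀⟩ := P.motif_nonempty
  refine ⟨∑ i, ‖B i‖, Finset.sum_nonneg (fun i _ => norm_nonneg _), fun z => ?_⟩
  have hfl : ((ZSpan.floor B (z - y₀) : Submodule.span ℤ (Set.range B)) : (EuclideanSpace ℝ (Fin 3))) ∈ P.lattice := by
    have h := (ZSpan.floor B (z - y₀)).2
    have hspan : Submodule.span ℤ (Set.range B) = P.lattice := b.ofZLatticeBasis_span ℝ P.lattice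
    exact hspan.le h
  refine ⟨y₀ + (ZSpan.floor B (z - y₀) : (EuclideanSpace ℝ (Fin 3))), P.add_mem_points (P.mem_points_of_mem_motif hy₀) hfl, ?_⟩
  have := ZSpan.norm_fract_le B (z - y₀)
  rw [ZSpan.fract_apply] at this
  calc dist z (y₀ + (ZSpan.floor B (z - y₀) : (EuclideanSpace ℝ (Fin 3))))
        = ‖z - y₀ - (ZSpan.floor B (z - y₀) : (EuclideanSpace ℝ (Fin 3)))‖ := by rw [dist_eq_norm, sub_sub]
    _ ≤ _ := this

/-- (L2) Third coordinates of stacking points are integer multiples of `H`. [folklore] -/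
theorem apply_two_of_mem {s : ℤ → ℤ} {p : (EuclideanSpace ℝ (Fin 3))} (hp : p ∈ barlowStacking 1 (Real.sqrt (2 / 3)) s) : ∃ n : ℤ, p 2 = n * (Real.sqrt (2 / 3)) := by
  obtain ⟨k, i, j, rfl⟩ := hp
  exact ⟨k, barlowPos_apply_two 1 (Real.sqrt (2 / 3)) s k i j⟩

/-- (L4) Every layer has a point laterally within `1` of any given point of space (round the two
skew coordinates). [folklore] -/
theorem exists_layer_point_near (s : ℤ → ℤ) (c : (EuclideanSpace ℝ (Fin 3))) (k : ℤ) :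
    ∃ i j : ℤ, dist (barlowPos 1 (Real.sqrt (2 / 3)) s k i j) c ^ 2 ≤ 1 + ((k : ℝ) * (Real.sqrt (2 / 3)) - c 2) ^ 2 := by
  set L : ℝ := ((haggLabel s k : ℤ) : ℝ) with hL
  set j : ℤ := round (2 * c 1 / Real.sqrt 3 - L / 3) with hj
  set i : ℤ := round (c 0 - j / 2 - L / 2) with hi
  refine ⟨i, j, ?_⟩
  have h3 : (0 : ℝ) < Real.sqrt 3 := by positivity
  have h3sq : Real.sqrt 3 ^ 2 = 3 := Real.sq_sqrt (by norm_num)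
  have hi' := abs_sub_round (c 0 - j / 2 - L / 2)
  have hj' := abs_sub_round (2 * c 1 / Real.sqrt 3 - L / 3)
  rw [← hi] at hi'
  rw [← hj] at hj'
  rw [EuclideanSpace.dist_sq_eq, Fin.sum_univ_three, Real.dist_eq, Real.dist_eq, Real.dist_eq,
    sq_abs, sq_abs, sq_abs, barlowPos_apply_zero, barlowPos_apply_one, barlowPos_apply_two]
  have e1 : (1 * ((i : ℝ) + j / 2 + haggLabel s k / 2) - c 0) ^ 2 ≤ 1 / 4 := by
    rw [← hL]
    have : |1 * ((i : ℝ) + j / 2 + L / 2) - c 0| ≤ 1 / 2 := by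
      have e : 1 * ((i : ℝ) + j / 2 + L / 2) - c 0 = -(c 0 - j / 2 - L / 2 - i) := by ring
      rw [e, abs_neg]; exact hi'
    nlinarith [abs_nonneg (1 * ((i : ℝ) + j / 2 + L / 2) - c 0), sq_abs (1 * ((i : ℝ) + j / 2 + L / 2) - c 0)]
  have e2 : (1 * Real.sqrt 3 / 2 * ((j : ℝ) + haggLabel s k / 3) - c 1) ^ 2 ≤ 3 / 16 := by
    rw [← hL]
    set u : ℝ := 2 * c 1 / Real.sqrt 3 - L / 3 - j with hu
    have hu' : |u| ≤ 1 / 2 := hj'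
    have : 1 * Real.sqrt 3 / 2 * ((j : ℝ) + L / 3) - c 1 = -(Real.sqrt 3 / 2) * u := by
      rw [hu]; field_simp; ring
    rw [this, mul_pow, neg_pow_two, div_pow, h3sq]
    nlinarith [abs_nonneg u, sq_abs u]
  nlinarith [e1, e2]

/-- (L5) The lateral lattice `ℤu + ℤv + ℤw` (`3w = u + v`): a vector `A u + B v + C w` of norm
`≤ 0.4` has `3 ∣ C` (its shortest vectors off `ℤu + ℤv` are `±w + Λ`, of norm `1/√3 > 0.4`).
[folklore] -/
theorem three_dvd_of_lateral_small {A B C : ℤ}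
    (h : ((A : ℝ) + B / 2 + C / 2) ^ 2 + (Real.sqrt 3 / 2 * (B + C / 3)) ^ 2 ≤ 0.16) :
    (3 : ℤ) ∣ C := by
  have h3sq : Real.sqrt 3 ^ 2 = 3 := Real.sq_sqrt (by norm_num)
  have hXW : ((3 * (2 * A + B + C) ^ 2 + (3 * B + C) ^ 2 : ℤ) : ℝ) < 2 := by
    push_cast
    have e : (Real.sqrt 3 / 2 * ((B : ℝ) + C / 3)) ^ 2 = (3 * B + C) ^ 2 / 12 := by
      rw [mul_pow, div_pow, h3sq]; ring
    rw [e] at h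
    nlinarith
  have hXW' : 3 * (2 * A + B + C) ^ 2 + (3 * B + C) ^ 2 < 2 := by exact_mod_cast hXW
  have hX : (2 * A + B + C) ^ 2 = 0 := by nlinarith [sq_nonneg (2 * A + B + C), sq_nonneg (3 * B + C)]
  have hX0 : 2 * A + B + C = 0 := pow_eq_zero_iff (n := 2) (by norm_num) |>.1 hX
  have hW : (3 * B + C) ^ 2 ≤ 1 := by nlinarith [sq_nonneg (2 * A + B + C)]
  obtain ⟨hW1, hW2⟩ := abs_le_one_of_sq_le_one hW
  omega

/-- (L6) **First-exit argument**: if the multiples `k γ`, `k ≤ n₀`, of a number `γ` with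
`n₀ |γ| ≥ 1` are all within `0.2` of `H ℤ`, then `γ` itself is within `0.2` of a NON-ZERO multiple
of `H` (otherwise the first multiple leaving `[-0.2, 0.2]` lands in `(0.2, 0.4]`, far from `Hℤ`).
[folklore] -/
theorem exists_transverse {γ : ℝ} {n₀ : ℕ} (hn₀ : 1 ≤ n₀ * |γ|)
    (hint : ∀ k : ℕ, k ≤ n₀ → ∃ n : ℤ, |k * γ - n * (Real.sqrt (2 / 3))| ≤ 0.2) :
    ∃ n : ℤ, n ≠ 0 ∧ |γ - n * (Real.sqrt (2 / 3))| ≤ 0.2 := by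
  classical
  have hH : (0.81 : ℝ) < Real.sqrt (2 / 3) ∧ Real.sqrt (2 / 3) < 0.82 :=
    ⟨by rw [Real.lt_sqrt (by norm_num)]; norm_num, by rw [Real.sqrt_lt' (by norm_num)]; norm_num⟩
  have H_pos : (0 : ℝ) < Real.sqrt (2 / 3) := Real.sqrt_pos.2 (by norm_num)
  have hn₀pos : 1 ≤ n₀ := by
    by_contra h
    have : n₀ = 0 := by omega
    subst this
    norm_num at hn₀
  obtain ⟨n₁, hn₁⟩ := hint 1 hn₀pos
  simp only [Nat.cast_one, one_mul] at hn₁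
  rcases ne_or_eq n₁ 0 with h | rfl
  · exact ⟨n₁, h, hn₁⟩
  exfalso
  simp only [Int.cast_zero, zero_mul, sub_zero] at hn₁
  have hex : ∃ k : ℕ, 0.2 < |(k : ℝ) * γ| :=
    ⟨n₀, by rw [abs_mul, Nat.abs_cast]; linarith⟩
  set k₀ := Nat.find hex with hk₀def
  have hk₀ : 0.2 < |(k₀ : ℝ) * γ| := Nat.find_spec hex
  have hk₀pos : 0 < k₀ := by
    by_contra h0
    have : k₀ = 0 := by omega
    rw [this] at hk₀
    norm_num at hk₀
  have hprev : ¬ 0.2 < |((k₀ - 1 : ℕ) : ℝ) * γ| := Nat.find_min hex (by omega)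
  have hk₀le : k₀ ≤ n₀ := Nat.find_min' hex (by rw [abs_mul, Nat.abs_cast]; linarith)
  obtain ⟨n, hn⟩ := hint k₀ hk₀le
  have h04 : |(k₀ : ℝ) * γ| ≤ 0.4 := by
    have e : (k₀ : ℝ) * γ = ((k₀ - 1 : ℕ) : ℝ) * γ + γ := by
      rw [Nat.cast_sub (by omega : 1 ≤ k₀)]; push_cast; ring
    rw [e]
    have := abs_add_le (((k₀ - 1 : ℕ) : ℝ) * γ) γ
    push Not at hprev
    linarith
  rcases eq_or_ne n 0 with rfl | hn0
  · simp only [Int.cast_zero, zero_mul, sub_zero] at hn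
    linarith
  · have h1 : (1 : ℝ) ≤ |(n : ℝ)| := by exact_mod_cast Int.one_le_abs hn0
    have h2 : 0.81 ≤ |(n : ℝ) * (Real.sqrt (2 / 3))| := by
      rw [abs_mul, abs_of_pos H_pos]; nlinarith
    have h3 := abs_sub_abs_le_abs_sub ((n : ℝ) * (Real.sqrt (2 / 3))) (k₀ * γ)
    rw [abs_sub_comm] at h3
    linarith

/-- A point of norm `ρ` diametrically opposite to `t` (any direction if `t = 0`). [folklore] -/
theorem exists_far_point (t : (EuclideanSpace ℝ (Fin 3))) {ρ : ℝ} (hρ : 0 ≤ ρ) {g : (EuclideanSpace ℝ (Fin 3))} (hg : g ≠ 0) :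
    ∃ z : (EuclideanSpace ℝ (Fin 3)), ‖z‖ = ρ ∧ ‖z - t‖ = ‖t‖ + ρ := by
  by_cases ht : t = 0
  · refine ⟨(ρ / ‖g‖) • g, ?_, ?_⟩
    · rw [norm_smul, Real.norm_eq_abs, abs_of_nonneg (by positivity), div_mul_cancel₀ _ (norm_ne_zero_iff.2 hg)]
    · rw [ht, sub_zero, norm_zero, zero_add, norm_smul, Real.norm_eq_abs, abs_of_nonneg (by positivity),
        div_mul_cancel₀ _ (norm_ne_zero_iff.2 hg)]
  · have htn : 0 < ‖t‖ := norm_pos_iff.2 ht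
    refine ⟨(-(ρ / ‖t‖)) • t, ?_, ?_⟩
    · rw [norm_smul, Real.norm_eq_abs, abs_neg, abs_of_nonneg (by positivity), div_mul_cancel₀ _ htn.ne']
    · have : (-(ρ / ‖t‖)) • t - t = (-(ρ / ‖t‖ + 1)) • t := by
        rw [show (-(ρ / ‖t‖ + 1)) = (-(ρ / ‖t‖) - 1) by ring, sub_smul, one_smul]
      rw [this, norm_smul, Real.norm_eq_abs, abs_neg, abs_of_nonneg (by positivity), add_mul, one_mul,
        div_mul_cancel₀ _ htn.ne', add_comm]

/-- Squared norm of a difference of two difference vectors of the unit stacking, in coordinates.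
[folklore] -/
theorem norm_sq_dd (s : ℤ → ℤ) (k i j k' i' j' l m n l' m' n' : ℤ) :
    ‖(barlowPos 1 (Real.sqrt (2 / 3)) s k' i' j' - barlowPos 1 (Real.sqrt (2 / 3)) s k i j) -
        (barlowPos 1 (Real.sqrt (2 / 3)) s l' m' n' - barlowPos 1 (Real.sqrt (2 / 3)) s l m n)‖ ^ 2 =
      ((((i' - i) - (m' - m) : ℤ) : ℝ) + (((j' - j) - (n' - n) : ℤ) : ℝ) / 2 +
          (((haggLabel s k' - haggLabel s k) - (haggLabel s l' - haggLabel s l) : ℤ) : ℝ) / 2) ^ 2 +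
        (Real.sqrt 3 / 2 * ((((j' - j) - (n' - n) : ℤ) : ℝ) +
          (((haggLabel s k' - haggLabel s k) - (haggLabel s l' - haggLabel s l) : ℤ) : ℝ) / 3)) ^ 2 +
        ((((k' - k) - (l' - l) : ℤ) : ℝ) * (Real.sqrt (2 / 3))) ^ 2 := by
  rw [← dist_eq_norm, EuclideanSpace.dist_sq_eq, Fin.sum_univ_three, Real.dist_eq, Real.dist_eq,
    Real.dist_eq, sq_abs, sq_abs, sq_abs]
  simp only [PiLp.sub_apply, barlowPos_apply_zero, barlowPos_apply_one, barlowPos_apply_two]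
  push_cast
  ring

end Summit.AtomisticToContinuum.Crystallization.Theorems.CleanLimitsHaveWindows.Negative

end
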